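import Mathlib
import Literature.Computability.AlgebraicComplexity.NestFreeMatchingPoly
import Summits.ValiantsHypothesis.ValiantsHypothesis.Theorems.FifoMatchingNNDivisionHardLinearTransportExplicit
import Summits.ValiantsHypothesis.ValiantsHypothesis.Theorems.FifoMatchingNNDivisionHardSplitFace
import Summits.ValiantsHypothesis.ValiantsHypothesis.Theorems.FifoMatchingNNMonomialCofactorHard
import Summits.ValiantsHypothesis.ValiantsHypothesis.Theorems.DivisionGapPerCofactorDegreeReductionStubMonomialStripping
import Summits.ValiantsHypothesis.ValiantsHypothesis.Theorems.FifoMatchingNNMonotoneExpBound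
import Summits.ValiantsHypothesis.ValiantsHypothesis.Theses.FifoMatching
import HarnessLib

/-!
# Route FifoMatching — crux `NNDivisionHard` (stmt-ValiantsHypothesis-21181): BLOCK-SHADOW-GENERIC cofactors are not
# certificates

A cofactor `h ≠ 0` is PREFIX-SHADOW-GENERIC at the block `L = [0, 2b)` if all monomials of `h` with the maximal number of
`L`-internal arc variables (the `𝟙_L`-top component) have the SAME restriction `μ` to the `L`-internal variables; likewise
SUFFIX-shadow-generic.  By the split face (`SplitFace.topComponent_lWeight`) and the explicit linear transport
(`LinearTransport.linear_transport_monomial`) such a certificate transports to the MONOMIAL cofactor `x^μ` at the block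
scale, where Jukna–Seiwert–Sergeev stripping (`MonomialStripping.complexity_le_of_monomial_mul`) removes it:

* `complexity_nn_mul_monomial_le_of_prefixGeneric`, `…_of_suffixGeneric` — `L₊(NN_b · x^μ) ≤ L₊(NN_{b+c} · h) + 2`;
* ★ `complexity_nn_le_of_prefixGeneric` (`'` = the `b ≤ n` form), `complexity_nn_le_of_suffixGeneric` —
  `L₊(NN_b) ≤ 16((2b+1)(L₊(NN_n · h) + 3))²`;
* ★★ `prefixGeneric_not_certificate_qp` — crux currency: for every `c`, eventually in `n`, every `h ≠ 0` that is
  prefix-shadow-generic at some block of half-length `b ≥ (log₂ n + c + 4)^{6(c+2)}` satisfies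
  `2^((log₂ n + c)^c) < L₊(NN_n · h) + L₊(h)`;
* ★ `nnDivisionHard_iff_prefixNonGenericTier` — BY NAME: `Theses.FifoMatching.NNDivisionHard` ⟺ the same inequality for the
  cofactors that are prefix-shadow-NON-generic at every block of half-length `≥ (log₂ n + c + 4)^{6(c+2)}` (at least two
  distinct `L`-shadows among the `𝟙_L`-heaviest monomials).

Block-avoiding cofactors (`…NNDivisionHardBlockAvoidance`) are the case `μ = 0` (there at additive cost); the pinned-rainbow generic rung of
`…NNDivisionHardStackPowersQueue` is the analogue for the direction `(n+1)·𝟙_R + 𝟙_{pins}`.  HONEST FRAMING: a rung family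
and a by-name localisation; the residual (… ∧ block-dense ∧ prefix-shadow-non-generic) stays OPEN (Hrubeš–Yehudayoff 2021
§6 Problem 2); nothing here bears on `NNNotVP` or on VP ≠ VNP (NOT proved).
References: Jukna–Seiwert–Sergeev 2022 Thm 1 [JuknaSeiwertSergeev2022]; Bürgisser 2000 Rem. 2.7 [Burgisser2000];
Hrubeš–Yehudayoff 2021 §6 Problem 2 [HrubesYehudayoff2021].
-/

noncomputable section

-- Sub = Summit single-conjunct layout: the duplicated namespace component is mandated by the tree.
set_option linter.dupNamespace false
set_option autoImplicit false

namespace Summit.ValiantsHypothesis.ValiantsHypothesis.Theorems.FifoMatching.NNDivisionHard.SplitFaceGeneric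

open Finset MvPolynomial Literature.Computability.AlgebraicComplexity
open Summit.ValiantsHypothesis.ValiantsHypothesis.Theorems.ZeroOneTransfer.Negative (topComponent)
open Summit.ValiantsHypothesis.ValiantsHypothesis.Theorems.FifoMatching.NNDivisionHard.StackPowersQueue
  (blockEmb blockEmb_injective)
open Summit.ValiantsHypothesis.ValiantsHypothesis.Theorems.FifoMatching.NNDivisionHard.LinearTransport
  (linear_transport_monomial)
open Summit.ValiantsHypothesis.ValiantsHypothesis.Theorems.FifoMatching.NNDivisionHard.SplitFace
  (lWeight blockEmbR two_mul_le blockEmbR_injective topComponent_lWeight support_rename_blockEmbR_outside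
    support_rename_blockEmb_outside)
open Summit.ValiantsHypothesis.ValiantsHypothesis.Theorems.DivisionGap.PerCofactorDegreeReduction.MonomialStripping
  (complexity_le_of_monomial_mul)
open scoped NNReal BigOperators

variable {b c : ℕ}

/-! ### §1 Shadow-generic cofactors transport to a monomial -/

/-- ★ **PREFIX-SHADOW-GENERIC COFACTORS** (additive form): if all `𝟙_L`-heaviest monomials of `h ≠ 0` restrict to `μ` on
the prefix block, then `L₊(NN_b · x^μ) ≤ L₊(NN_{b+c} · h) + 2`. [cite: Burgisser2000, Rem. 2.7] -/
theorem complexity_nn_mul_monomial_le_of_prefixGeneric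
    {h : MvPolynomial (Fin (2 * (b + c)) × Fin (2 * (b + c))) ℝ≥0} (hh : h ≠ 0)
    (μ : (Fin (2 * b) × Fin (2 * b)) →₀ ℕ)
    (hgen : ∀ m ∈ (topComponent (lWeight b c) h).support, ∀ t, m (blockEmb (two_mul_le b c) t) = μ t) :
    complexity (nestFreeMatchingPoly b ℝ≥0 * monomial μ 1) ≤ complexity (nestFreeMatchingPoly (b + c) ℝ≥0 * h) + 2 :=
  linear_transport_monomial (blockEmb_injective (two_mul_le b c)) (lWeight b c) topComponent_lWeight
    (fun h0 => MonomialCofactor.nn_ne_zero c (rename_injective _ blockEmbR_injective (by rw [h0, map_zero])))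
    (support_rename_blockEmbR_outside _) hh μ hgen

/-- ★ **SUFFIX-SHADOW-GENERIC COFACTORS** (additive form). [cite: Burgisser2000, Rem. 2.7] -/
theorem complexity_nn_mul_monomial_le_of_suffixGeneric
    {h : MvPolynomial (Fin (2 * (b + c)) × Fin (2 * (b + c))) ℝ≥0} (hh : h ≠ 0)
    (μ : (Fin (2 * c) × Fin (2 * c)) →₀ ℕ)
    (hgen : ∀ m ∈ (topComponent (lWeight b c) h).support, ∀ t, m (blockEmbR b c t) = μ t) :
    complexity (nestFreeMatchingPoly c ℝ≥0 * monomial μ 1) ≤ complexity (nestFreeMatchingPoly (b + c) ℝ≥0 * h) + 2 :=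
  linear_transport_monomial blockEmbR_injective (lWeight b c) (topComponent_lWeight.trans (mul_comm _ _))
    (fun h0 => MonomialCofactor.nn_ne_zero b
      (rename_injective _ (blockEmb_injective (two_mul_le b c)) (by rw [h0, map_zero])))
    (support_rename_blockEmb_outside _) hh μ hgen

/-- ★ **PREFIX-SHADOW-GENERIC COFACTORS**, after Jukna–Seiwert–Sergeev stripping at the block scale:
`L₊(NN_b) ≤ 16((2b+1)(L₊(NN_{b+c} · h) + 3))²`. [cite: JuknaSeiwertSergeev2022, Thm 1] -/
theorem complexity_nn_le_of_prefixGeneric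
    {h : MvPolynomial (Fin (2 * (b + c)) × Fin (2 * (b + c))) ℝ≥0} (hh : h ≠ 0)
    (μ : (Fin (2 * b) × Fin (2 * b)) →₀ ℕ)
    (hgen : ∀ m ∈ (topComponent (lWeight b c) h).support, ∀ t, m (blockEmb (two_mul_le b c) t) = μ t) :
    complexity (nestFreeMatchingPoly b ℝ≥0) ≤
      16 * ((2 * b + 1) * (complexity (nestFreeMatchingPoly (b + c) ℝ≥0 * h) + 3)) ^ 2 := by
  have H := complexity_nn_mul_monomial_le_of_prefixGeneric hh μ hgen
  rw [mul_comm (nestFreeMatchingPoly b ℝ≥0)] at H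
  have H' : complexity (monomial μ (1 : ℝ≥0) * nestFreeMatchingPoly b ℝ≥0) + 1 ≤
      complexity (nestFreeMatchingPoly (b + c) ℝ≥0 * h) + 3 := by omega
  calc complexity (nestFreeMatchingPoly b ℝ≥0)
      ≤ 16 * ((2 * b + 1) * (complexity (monomial μ (1 : ℝ≥0) * nestFreeMatchingPoly b ℝ≥0) + 1)) ^ 2 :=
        complexity_le_of_monomial_mul (2 * b) μ _
    _ ≤ 16 * ((2 * b + 1) * (complexity (nestFreeMatchingPoly (b + c) ℝ≥0 * h) + 3)) ^ 2 := by gcongr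

/-- ★ **SUFFIX-SHADOW-GENERIC COFACTORS**, after stripping: `L₊(NN_c) ≤ 16((2c+1)(L₊(NN_{b+c} · h) + 3))²`.
[cite: JuknaSeiwertSergeev2022, Thm 1] -/
theorem complexity_nn_le_of_suffixGeneric
    {h : MvPolynomial (Fin (2 * (b + c)) × Fin (2 * (b + c))) ℝ≥0} (hh : h ≠ 0)
    (μ : (Fin (2 * c) × Fin (2 * c)) →₀ ℕ)
    (hgen : ∀ m ∈ (topComponent (lWeight b c) h).support, ∀ t, m (blockEmbR b c t) = μ t) :
    complexity (nestFreeMatchingPoly c ℝ≥0) ≤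
      16 * ((2 * c + 1) * (complexity (nestFreeMatchingPoly (b + c) ℝ≥0 * h) + 3)) ^ 2 := by
  have H := complexity_nn_mul_monomial_le_of_suffixGeneric hh μ hgen
  rw [mul_comm (nestFreeMatchingPoly c ℝ≥0)] at H
  have H' : complexity (monomial μ (1 : ℝ≥0) * nestFreeMatchingPoly c ℝ≥0) + 1 ≤
      complexity (nestFreeMatchingPoly (b + c) ℝ≥0 * h) + 3 := by omega
  calc complexity (nestFreeMatchingPoly c ℝ≥0)
      ≤ 16 * ((2 * c + 1) * (complexity (monomial μ (1 : ℝ≥0) * nestFreeMatchingPoly c ℝ≥0) + 1)) ^ 2 :=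
        complexity_le_of_monomial_mul (2 * c) μ _
    _ ≤ 16 * ((2 * c + 1) * (complexity (nestFreeMatchingPoly (b + c) ℝ≥0 * h) + 3)) ^ 2 := by gcongr

/-- ★ **PREFIX-SHADOW-GENERIC COFACTORS, `b ≤ n` form** (the left-internal direction written out on `[0, 2n)`).
[cite: JuknaSeiwertSergeev2022, Thm 1] -/
theorem complexity_nn_le_of_prefixGeneric' {n b : ℕ} (hb : b ≤ n)
    {h : MvPolynomial (Fin (2 * n) × Fin (2 * n)) ℝ≥0} (hh : h ≠ 0)
    (μ : (Fin (2 * b) × Fin (2 * b)) →₀ ℕ)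
    (hgen : ∀ m ∈ (topComponent (fun e : Fin (2 * n) × Fin (2 * n) =>
        if (e.1 : ℕ) < 2 * b ∧ (e.2 : ℕ) < 2 * b then 1 else 0) h).support,
      ∀ t, m (blockEmb (Nat.mul_le_mul_left 2 hb) t) = μ t) :
    complexity (nestFreeMatchingPoly b ℝ≥0) ≤
      16 * ((2 * b + 1) * (complexity (nestFreeMatchingPoly n ℝ≥0 * h) + 3)) ^ 2 := by
  obtain ⟨c, rfl⟩ := Nat.exists_eq_add_of_le hb
  exact complexity_nn_le_of_prefixGeneric hh μ hgen

/-! ### §2 Crux currency -/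

/-- Exponent bookkeeping: `2(ℓ+c)^c + 2ℓ + 14 ≤ (ℓ+c+4)^(c+2)` for `ℓ ≥ 1`. [folklore] -/
theorem two_mul_pow_add_le (ℓ c : ℕ) (hℓ : 1 ≤ ℓ) : 2 * (ℓ + c) ^ c + 2 * ℓ + 14 ≤ (ℓ + c + 4) ^ (c + 2) := by
  have hE : 1 ≤ (ℓ + c) ^ c := Nat.one_le_pow _ _ (by omega)
  have h1 : (ℓ + c) ^ c ≤ (ℓ + c + 4) ^ c := Nat.pow_le_pow_left (by omega) c
  have h2 : 5 * ℓ + 20 ≤ (ℓ + c + 4) ^ 2 :=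
    calc 5 * ℓ + 20 = 5 * (ℓ + 4) := by ring
      _ ≤ (ℓ + c + 4) * (ℓ + c + 4) := Nat.mul_le_mul (by omega) (by omega)
      _ = (ℓ + c + 4) ^ 2 := (sq _).symm
  have h3 : 5 * ℓ + 18 ≤ (ℓ + c) ^ c * (5 * ℓ + 18) := Nat.le_mul_of_pos_left _ hE
  calc 2 * (ℓ + c) ^ c + 2 * ℓ + 14 ≤ 2 * (ℓ + c) ^ c + (ℓ + c) ^ c * (5 * ℓ + 18) := by omega
    _ = (ℓ + c) ^ c * (5 * ℓ + 20) := by ring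
    _ ≤ (ℓ + c + 4) ^ c * (ℓ + c + 4) ^ 2 := Nat.mul_le_mul h1 h2
    _ = (ℓ + c + 4) ^ (c + 2) := by rw [← pow_add]

/-- ★★ **PREFIX-SHADOW-GENERIC COFACTORS ARE NOT CERTIFICATES.**  For every `c`, eventually in `n`: every `h ≠ 0` which is
prefix-shadow-generic at some block of half-length `b ≥ (log₂ n + c + 4)^{6(c+2)}`, `b ≤ n`, satisfies the crux inequality
`2^((log₂ n + c)^c) < L₊(NN_n · h) + L₊(h)`. [cite: JuknaSeiwertSergeev2022, Thm 1] [cite: HrubesYehudayoff2021, §6 Problem 2] -/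
theorem prefixGeneric_not_certificate_qp (c : ℕ) : ∃ n₀ : ℕ, ∀ n : ℕ, n₀ ≤ n → ∀ b : ℕ, ∀ hb : b ≤ n,
    (Nat.log 2 n + c + 4) ^ (6 * (c + 2)) ≤ b →
    ∀ h : MvPolynomial (Fin (2 * n) × Fin (2 * n)) ℝ≥0, h ≠ 0 →
    ∀ μ : (Fin (2 * b) × Fin (2 * b)) →₀ ℕ,
    (∀ m ∈ (topComponent (fun e : Fin (2 * n) × Fin (2 * n) =>
        if (e.1 : ℕ) < 2 * b ∧ (e.2 : ℕ) < 2 * b then 1 else 0) h).support,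
      ∀ t, m (blockEmb (Nat.mul_le_mul_left 2 hb) t) = μ t) →
    2 ^ ((Nat.log 2 n + c) ^ c) < complexity (nestFreeMatchingPoly n ℝ≥0 * h) + complexity h := by
  obtain ⟨n₁, hn₁⟩ := NNMonotoneExpBound.exp_lower_bound
  refine ⟨2 ^ (n₁ + 1), fun n hn b hb hbig h hh μ hgen => ?_⟩
  have hℓ1 : n₁ + 1 ≤ Nat.log 2 n := Nat.le_log_of_pow_le Nat.one_lt_two hn
  set ℓ := Nat.log 2 n with hℓ
  set A := complexity (nestFreeMatchingPoly n ℝ≥0 * h) with hA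
  have hT6 : ((ℓ + c + 4) ^ (c + 2)) ^ 6 ≤ b := by rw [← pow_mul, mul_comm]; exact hbig
  have hbT : n₁ ≤ b := by
    have : ℓ + c + 4 ≤ (ℓ + c + 4) ^ (6 * (c + 2)) := Nat.le_self_pow (by omega) _
    omega
  -- real bookkeeping: `T⁶ ≤ b` and `2^{b^{1/6}} ≤ L₊(NN_b)` give `2^T ≤ L₊(NN_b)`
  have hX : 2 ^ ((ℓ + c + 4) ^ (c + 2)) ≤ complexity (nestFreeMatchingPoly b ℝ≥0) := by
    set T := (ℓ + c + 4) ^ (c + 2) with hT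
    have h6 : (((T : ℝ) ^ 6)) ^ ((1 : ℝ) / 6) = T := by
      rw [one_div, show (6 : ℝ) = ((6 : ℕ) : ℝ) by norm_num]
      exact Real.pow_rpow_inv_natCast (Nat.cast_nonneg _) (by norm_num)
    have e1 : (T : ℝ) ≤ (b : ℝ) ^ ((1 : ℝ) / 6) := by
      calc (T : ℝ) = ((T : ℝ) ^ 6) ^ ((1 : ℝ) / 6) := h6.symm
        _ ≤ (b : ℝ) ^ ((1 : ℝ) / 6) := Real.rpow_le_rpow (by positivity) (by exact_mod_cast hT6) (by norm_num)
    have e2 : (2 : ℝ) ^ (T : ℝ) ≤ (2 : ℝ) ^ ((b : ℝ) ^ ((1 : ℝ) / 6)) :=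
      Real.rpow_le_rpow_of_exponent_le one_le_two e1
    have e3 : ((2 ^ T : ℕ) : ℝ) ≤ (complexity (nestFreeMatchingPoly b ℝ≥0) : ℝ) := by
      rw [Nat.cast_pow, Nat.cast_ofNat, ← Real.rpow_natCast]
      exact e2.trans (hn₁ b hbT)
    exact_mod_cast e3
  have h3 := complexity_nn_le_of_prefixGeneric' hb hh μ hgen
  have hTE : 2 * (ℓ + c) ^ c + 2 * ℓ + 14 ≤ (ℓ + c + 4) ^ (c + 2) := two_mul_pow_add_le ℓ c (by omega)
  -- `2b + 1 ≤ 2n + 1 ≤ 2^(ℓ+2)`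
  have hlogn : 2 * n + 1 ≤ 2 ^ (ℓ + 2) := by
    have := Nat.lt_pow_succ_log_self Nat.one_lt_two n
    rw [hℓ, pow_succ] at *
    omega
  have hb2 : 2 * b + 1 ≤ 2 ^ (ℓ + 2) := by omega
  -- chain: `2^(2E+2ℓ+14) ≤ 2^T ≤ L₊(NN_b) ≤ 16 (2^(ℓ+2))² (A+3)²`
  have H1 : 2 ^ (2 * (ℓ + c) ^ c + 2 * ℓ + 14) ≤ 16 * (2 ^ (ℓ + 2) * (A + 3)) ^ 2 :=
    calc 2 ^ (2 * (ℓ + c) ^ c + 2 * ℓ + 14) ≤ 2 ^ ((ℓ + c + 4) ^ (c + 2)) := Nat.pow_le_pow_right Nat.two_pos hTE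
      _ ≤ complexity (nestFreeMatchingPoly b ℝ≥0) := hX
      _ ≤ 16 * ((2 * b + 1) * (A + 3)) ^ 2 := h3
      _ ≤ 16 * (2 ^ (ℓ + 2) * (A + 3)) ^ 2 := by gcongr
  have H2 : 2 ^ (2 * (ℓ + c) ^ c + 2 * ℓ + 14) = 16 * (2 ^ (ℓ + 2)) ^ 2 * (2 ^ ((ℓ + c) ^ c + 3)) ^ 2 := by
    rw [← pow_mul, ← pow_mul, show (16 : ℕ) = 2 ^ 4 by norm_num, ← pow_add, ← pow_add]
    congr 1
    ring
  have H3 : (2 ^ ((ℓ + c) ^ c + 3)) ^ 2 ≤ (A + 3) ^ 2 := by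
    have hK : 0 < 16 * (2 ^ (ℓ + 2)) ^ 2 := by positivity
    rw [H2, mul_pow] at H1
    rw [← mul_assoc] at H1
    exact Nat.le_of_mul_le_mul_left H1 hK
  have H4 : 2 ^ ((ℓ + c) ^ c + 3) ≤ A + 3 := (Nat.pow_le_pow_iff_left (by norm_num)).1 H3
  have hE1 : 1 ≤ 2 ^ ((ℓ + c) ^ c) := Nat.one_le_two_pow
  have h8 : 2 ^ ((ℓ + c) ^ c + 3) = 8 * 2 ^ ((ℓ + c) ^ c) := by ring
  omega

/-- ★ **BY NAME: `NNDivisionHard` ⟺ its PREFIX-SHADOW-NON-GENERIC tier.**  The crux (stmt-ValiantsHypothesis-21181) is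
equivalent to the same inequality for the cofactors whose `𝟙_L`-heaviest monomials have at least two distinct restrictions
to `L`, for EVERY prefix block `L = [0, 2b)` with `(log₂ n + c + 4)^{6(c+2)} ≤ b ≤ n`. [cite: HrubesYehudayoff2021, §6 Problem 2] -/
theorem nnDivisionHard_iff_prefixNonGenericTier :
    Summit.ValiantsHypothesis.ValiantsHypothesis.Theses.FifoMatching.NNDivisionHard ↔
    ∀ c : ℕ, ∃ n₀ : ℕ, ∀ n ≥ n₀, ∀ h : MvPolynomial (Fin (2 * n) × Fin (2 * n)) ℝ≥0, h ≠ 0 →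
      (∀ b : ℕ, ∀ hb : b ≤ n, (Nat.log 2 n + c + 4) ^ (6 * (c + 2)) ≤ b →
        ∀ μ : (Fin (2 * b) × Fin (2 * b)) →₀ ℕ,
          ∃ m ∈ (topComponent (fun e : Fin (2 * n) × Fin (2 * n) =>
              if (e.1 : ℕ) < 2 * b ∧ (e.2 : ℕ) < 2 * b then 1 else 0) h).support,
            ∃ t, m (blockEmb (Nat.mul_le_mul_left 2 hb) t) ≠ μ t) →
      2 ^ ((Nat.log 2 n + c) ^ c) < complexity (nestFreeMatchingPoly n ℝ≥0 * h) + complexity h := by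
  constructor
  · intro hN c
    obtain ⟨n₀, hn₀⟩ := hN c
    exact ⟨n₀, fun n hn h hh _ => hn₀ n hn h hh⟩
  · intro H c
    obtain ⟨n₀, hn₀⟩ := H c
    obtain ⟨n₁, hn₁⟩ := prefixGeneric_not_certificate_qp c
    refine ⟨max n₀ n₁, fun n hn h hh => ?_⟩
    by_contra hcon
    apply hcon
    apply hn₀ n (le_trans (le_max_left _ _) hn) h hh
    intro b hb hbig μ
    by_contra hne
    refine hcon (hn₁ n (le_trans (le_max_right _ _) hn) b hb hbig h hh μ fun m hm t => ?_)
    by_contra hmt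
    exact hne ⟨m, hm, t, hmt⟩

end Summit.ValiantsHypothesis.ValiantsHypothesis.Theorems.FifoMatching.NNDivisionHard.SplitFaceGeneric

end
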